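import Mathlib
import HarnessLib
import Summits.HubbardSuperconductivity.HubbardSuperconductivity.Theorems.KLProgrammeKLRegimeEngineLegPairFourierMoments
import Summits.HubbardSuperconductivity.HubbardSuperconductivity.Theorems.KLProgrammeKLRegimeSplitFieldStrengthTimeMoment
import Summits.HubbardSuperconductivity.HubbardSuperconductivity.Theorems.KLProgrammeKLRegimeTwoVolumeResummedSymbolKernels
import Literature.Probability.LatticeModels.TorusFourierWeightedConvolution

/-!
# K3 gen-8-FLOW (stmt 20437, stub (C), #20 (δ′) «LAST-STEP SWAP»): THE E1-SIDE MOMENT ROWS OF THE (δ′) DOOR FROM POSITION SPACE (seat p2 g21; pen (R220))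

The #20 (δ′) door (`…LastStepResponseBracketFlowFinalGraded.lastResponse_bracket_flow_final_graded`, p646565) reads `hMm_b/hMs_b` — lattice moments
`Σ_y (1+|ỹ₀|+|ỹ₁|)ʲ‖𝔉⁻¹[k⃗ ↦ klLocSelfEnergyRe … K N k⃗](y)‖` — and `hMm_c/hMs_c` — the same moments of the odd average `k⃗ ↦ ¼Σ_σ[Im Σ(ω₀,k⃗,σ) − Im Σ(−ω₀,k⃗,σ)]`.
The tower speaks pinned weighted `L¹` norms of the POSITION kernel `W(σ;x) = sectorisedKernel β 1 G 2 ((σ,+),(σ,−)) x` (class-#7 currency).  Bridge, ANY `G`, `β > 0`,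
every order `j` (even weight `w_j(z) = (1+|z̃₀|+|z̃₁|)ʲ`):
* §1 `norm_torusFourierInv_im_le`, `sum_momentWeight_norm_torusFourierInv_re_le` / `_im_le` (`Σ_y w_j‖(Re f)ˇ‖ ≤ Σ_y w_j‖f̌‖`, same for `Im`);
* §2 (`b`) `sum_momentWeight_norm_torusFourierInv_selfEnergy_le` (`ε·Σ_{x : x 0 = x₀} w_j(x⃗₁−x⃗₀)‖W(σ;x)‖ ≤ Ms` ∀ pins ⟹ `Σ_y w_j‖𝔉⁻¹[Σ((n,·),σ)]‖ ≤ 2Ms`;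
  `Σ = 2βL²·F₂`), **`sum_momentWeight_norm_torusFourierInv_klLocSelfEnergyRe_le`** (both spins `≤ Ms` ⟹ the `hMm_b/hMs_b` sums `≤ 2·Ms`);
* §3 (`c`) `card_sq_mul_norm_torusFourierInv_kernel_two_sub_rev_le` (y-resolved inversion of `F₂(ω₀,·) − F₂(−ω₀,·)`; phases differ by
  `2|sin((π/β)Δt)| ≤ (2π/β)·ε·circDist`), `sum_weight_norm_torusFourierInv_kernel_two_sub_rev_le` (`≤ (2π/β)Mt/(βL²)` from the TIME × space weighted pinned norm
  `ε·Σ_{x : x 0 = x₀} w(x⃗₁−x⃗₀)·ε·circDist_{2M}(t₀,t₁)·‖W(σ;x)‖ ≤ Mt`), `sum_momentWeight_norm_torusFourierInv_selfEnergy_sub_rev_le` (`≤ 4(π/β)Mt`),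
  **`sum_momentWeight_norm_torusFourierInv_oddAverage_le`** (both spins `≤ Mt` ⟹ the `hMm_c/hMs_c` sums `≤ 2(π/β)·Mt`; the ONE scale gain `π/β ≤ (1/32)/4^{n_β}`).
Proofs only; no definitions; the position norms are hypotheses (tower output); nothing asserts superconductivity.
References: BGM 2006 §2.1 (2.4)–(2.5), §2.3 (2.17), §2.4 (2.36) [cite: BenfattoGiulianiMastropietro2006].
-/

noncomputable section

namespace Summit.HubbardSuperconductivity.HubbardSuperconductivity.Theorems.TwoLegFourier

set_option linter.dupNamespace false -- summit = problem name (single-conjunct summit), D-0017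

open Finset Complex
open Literature.MathematicalPhysics.QuantumLattice Literature.Probability.LatticeModels GrassmannAlgebra
open Summit.HubbardSuperconductivity.HubbardSuperconductivity.Theorems.KLRegimeSplit
open Summit.HubbardSuperconductivity.HubbardSuperconductivity.Theorems.KLProgrammeLegKernels

variable {L M : ℕ} [NeZero L]
/-! ## §1 Real and imaginary parts under the even moment weight -/

omit [NeZero L] in
/-- **The kernel of an imaginary part**: `‖(Im f : ℂ)ˇ(y)‖ ≤ (‖f̌(y)‖ + ‖f̌(−y)‖)/2` (`Im f = Re(−i·f)`). -/
theorem norm_torusFourierInv_im_le [NeZero L] (f : TorusSite 2 L → ℂ) (y : TorusSite 2 L) :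
    ‖torusFourierInv (fun k => (((f k).im : ℝ) : ℂ)) y‖ ≤ (‖torusFourierInv f y‖ + ‖torusFourierInv f (-y)‖) / 2 := by
  have him : (fun k => (((f k).im : ℝ) : ℂ)) = fun k => ((((-I * f k)).re : ℝ) : ℂ) := by
    funext k; congr 1; simp [Complex.mul_re]
  have h := TwoVolumeDefect.norm_torusFourierInv_re_le (fun k => -I * f k) y
  have hc : ∀ z, ‖torusFourierInv (fun k => -I * f k) z‖ = ‖torusFourierInv f z‖ := fun z => by
    rw [torusFourierInv_const_mul, norm_mul, norm_neg, Complex.norm_I, one_mul]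
  rw [him]
  simpa only [hc] using h

/-- **`Σ_y w_j(y)‖(Re f)ˇ(y)‖ ≤ Σ_y w_j(y)‖f̌(y)‖`** for the even weight `w_j(y) = (1+|ỹ₀|+|ỹ₁|)ʲ`. -/
theorem sum_momentWeight_norm_torusFourierInv_re_le (j : ℕ) (f : TorusSite 2 L → ℂ) :
    ∑ y : TorusSite 2 L, (1 + ((y 0).valMinAbs.natAbs : ℝ) + ((y 1).valMinAbs.natAbs : ℝ)) ^ j * ‖torusFourierInv (fun k => (((f k).re : ℝ) : ℂ)) y‖ ≤
      ∑ y : TorusSite 2 L, (1 + ((y 0).valMinAbs.natAbs : ℝ) + ((y 1).valMinAbs.natAbs : ℝ)) ^ j * ‖torusFourierInv f y‖ := by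
  set w : TorusSite 2 L → ℝ := fun y => (1 + ((y 0).valMinAbs.natAbs : ℝ) + ((y 1).valMinAbs.natAbs : ℝ)) ^ j with hw
  have hw0 : ∀ y, 0 ≤ w y := fun y => by rw [hw]; positivity
  have hneg : ∑ y : TorusSite 2 L, w y * ‖torusFourierInv f (-y)‖ = ∑ y : TorusSite 2 L, w y * ‖torusFourierInv f y‖ := by
    have h1 : ∑ y : TorusSite 2 L, w y * ‖torusFourierInv f (-y)‖ = ∑ y : TorusSite 2 L, w (-y) * ‖torusFourierInv f y‖ :=
      Fintype.sum_equiv (Equiv.neg _) _ _ fun y => by simp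
    rw [h1]
    exact sum_congr rfl fun y _ => by rw [hw]; simp only; rw [momentWeight_neg]
  calc ∑ y, w y * ‖torusFourierInv (fun k => (((f k).re : ℝ) : ℂ)) y‖
      ≤ ∑ y, w y * ((‖torusFourierInv f y‖ + ‖torusFourierInv f (-y)‖) / 2) :=
        sum_le_sum fun y _ => mul_le_mul_of_nonneg_left (TwoVolumeDefect.norm_torusFourierInv_re_le f y) (hw0 y)
    _ = ((∑ y, w y * ‖torusFourierInv f y‖) + ∑ y, w y * ‖torusFourierInv f (-y)‖) / 2 := by
        rw [← sum_add_distrib, Finset.sum_div]; exact sum_congr rfl fun y _ => by ring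
    _ = ∑ y, w y * ‖torusFourierInv f y‖ := by rw [hneg]; ring

/-- **`Σ_y w_j(y)‖(Im f)ˇ(y)‖ ≤ Σ_y w_j(y)‖f̌(y)‖`** for the even weight. -/
theorem sum_momentWeight_norm_torusFourierInv_im_le (j : ℕ) (f : TorusSite 2 L → ℂ) :
    ∑ y : TorusSite 2 L, (1 + ((y 0).valMinAbs.natAbs : ℝ) + ((y 1).valMinAbs.natAbs : ℝ)) ^ j * ‖torusFourierInv (fun k => (((f k).im : ℝ) : ℂ)) y‖ ≤
      ∑ y : TorusSite 2 L, (1 + ((y 0).valMinAbs.natAbs : ℝ) + ((y 1).valMinAbs.natAbs : ℝ)) ^ j * ‖torusFourierInv f y‖ := by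
  set w : TorusSite 2 L → ℝ := fun y => (1 + ((y 0).valMinAbs.natAbs : ℝ) + ((y 1).valMinAbs.natAbs : ℝ)) ^ j with hw
  have hw0 : ∀ y, 0 ≤ w y := fun y => by rw [hw]; positivity
  have hneg : ∑ y : TorusSite 2 L, w y * ‖torusFourierInv f (-y)‖ = ∑ y : TorusSite 2 L, w y * ‖torusFourierInv f y‖ := by
    have h1 : ∑ y : TorusSite 2 L, w y * ‖torusFourierInv f (-y)‖ = ∑ y : TorusSite 2 L, w (-y) * ‖torusFourierInv f y‖ :=
      Fintype.sum_equiv (Equiv.neg _) _ _ fun y => by simp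
    rw [h1]
    exact sum_congr rfl fun y _ => by rw [hw]; simp only; rw [momentWeight_neg]
  calc ∑ y, w y * ‖torusFourierInv (fun k => (((f k).im : ℝ) : ℂ)) y‖
      ≤ ∑ y, w y * ((‖torusFourierInv f y‖ + ‖torusFourierInv f (-y)‖) / 2) :=
        sum_le_sum fun y _ => mul_le_mul_of_nonneg_left (norm_torusFourierInv_im_le f y) (hw0 y)
    _ = ((∑ y, w y * ‖torusFourierInv f y‖) + ∑ y, w y * ‖torusFourierInv f (-y)‖) / 2 := by
        rw [← sum_add_distrib, Finset.sum_div]; exact sum_congr rfl fun y _ => by ring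
    _ = ∑ y, w y * ‖torusFourierInv f y‖ := by rw [hneg]; ring
/-! ## §2 The `b` channel: moments of `𝔉⁻¹[klLocSelfEnergyRe]` from the pinned spatial norms -/

/-- **Moments of `𝔉⁻¹[k⃗ ↦ Σ((n,k⃗),σ)]` from position space**: `≤ 2·Ms` whenever `ε·Σ_{x : x 0 = x₀} w_j(x⃗₁ − x⃗₀)‖W(σ;x)‖ ≤ Ms` for every pin
(`Σ = 2βL²·F₂`, `…kernel_two_le`). [cite: BenfattoGiulianiMastropietro2006, §2.3 (2.17)] -/
theorem sum_momentWeight_norm_torusFourierInv_selfEnergy_le [NeZero M] {β : ℝ} (hβ : 0 < β) (G : HubbardGrassmann L M)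
    (n : MatsubaraIdx M) (σ : Fin 2) (j : ℕ) {Ms : ℝ}
    (hM : ∀ x₀ : SpaceTimeIdx L M, imagTimeWeight β M *
      ∑ x ∈ (univ : Finset (Fin 2 → SpaceTimeIdx L M)).filter (fun x => x 0 = x₀),
        (1 + ((((x 1).2 - (x 0).2) 0).valMinAbs.natAbs : ℝ) + ((((x 1).2 - (x 0).2) 1).valMinAbs.natAbs : ℝ)) ^ j *
          ‖sectorisedKernel L M β (trivialMultiplier L M) G 2 (![((0, σ), 0), ((0, σ), 1)] : Fin 2 → SectorLeg 1) x‖ ≤ Ms) :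
    ∑ y : TorusSite 2 L, (1 + ((y 0).valMinAbs.natAbs : ℝ) + ((y 1).valMinAbs.natAbs : ℝ)) ^ j *
        ‖torusFourierInv (fun kv : TorusSite 2 L => selfEnergy L M β G (n, kv) σ) y‖ ≤ 2 * Ms := by
  have hL : (0 : ℝ) < (L : ℝ) := by exact_mod_cast Nat.pos_of_ne_zero (NeZero.ne L)
  have hker := sum_weight_mul_norm_torusFourierInv_kernel_two_le hβ G n σ
    (w := fun z => (1 + ((z 0).valMinAbs.natAbs : ℝ) + ((z 1).valMinAbs.natAbs : ℝ)) ^ j) (fun z => by positivity) hM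
  have hfun : (fun kv : TorusSite 2 L => selfEnergy L M β G (n, kv) σ) =
      fun kv => ((2 * (β * (L : ℝ) ^ 2) : ℝ) : ℂ) * kernel ℂ G 2 ![(((n, kv), σ), 0), (((n, kv), σ), 1)] := by
    funext kv; exact selfEnergy_eq_vertexFn β G (n, kv) σ
  have hpt : ∀ y, ‖torusFourierInv (fun kv : TorusSite 2 L => selfEnergy L M β G (n, kv) σ) y‖ =
      (2 * (β * (L : ℝ) ^ 2)) * ‖torusFourierInv (fun kv : TorusSite 2 L => kernel ℂ G 2 ![(((n, kv), σ), 0), (((n, kv), σ), 1)]) y‖ := by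
    intro y
    rw [hfun, torusFourierInv_const_mul, norm_mul, Complex.norm_real, Real.norm_eq_abs, abs_of_pos (by positivity)]
  simp_rw [hpt]
  calc ∑ y : TorusSite 2 L, (1 + ((y 0).valMinAbs.natAbs : ℝ) + ((y 1).valMinAbs.natAbs : ℝ)) ^ j *
        ((2 * (β * (L : ℝ) ^ 2)) * ‖torusFourierInv (fun kv : TorusSite 2 L => kernel ℂ G 2 ![(((n, kv), σ), 0), (((n, kv), σ), 1)]) y‖)
      = (2 * (β * (L : ℝ) ^ 2)) * ∑ y : TorusSite 2 L, (1 + ((y 0).valMinAbs.natAbs : ℝ) + ((y 1).valMinAbs.natAbs : ℝ)) ^ j *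
          ‖torusFourierInv (fun kv : TorusSite 2 L => kernel ℂ G 2 ![(((n, kv), σ), 0), (((n, kv), σ), 1)]) y‖ := by
        rw [mul_sum]; exact sum_congr rfl fun y _ => by ring
    _ ≤ (2 * (β * (L : ℝ) ^ 2)) * (Ms / (β * (L : ℝ) ^ 2)) := mul_le_mul_of_nonneg_left hker (by positivity)
    _ = 2 * Ms := by field_simp

/-- **THE `hMm_b/hMs_b` ROWS OF THE (δ′) DOOR FROM POSITION SPACE.**  For the scale-`n` action `klEffectiveAction … K klE0 n` at any frame `K`: if both
spin strings' trivial-multiplier two-leg position kernels have pinned `w_j`-weighted norm `≤ Ms`, then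
`Σ_y w_j(y)‖𝔉⁻¹[k⃗ ↦ klLocSelfEnergyRe … K n k⃗](y)‖ ≤ 2·Ms`. [cite: BenfattoGiulianiMastropietro2006, §2.4 (2.36)] -/
theorem sum_momentWeight_norm_torusFourierInv_klLocSelfEnergyRe_le [NeZero M] {β : ℝ} (hβ : 0 < β) (U μ : ℝ) (K : TrigPolyC4v) (n j : ℕ)
    {Ms : ℝ}
    (hMs : ∀ (σ : Fin 2) (x₀ : SpaceTimeIdx L M), imagTimeWeight β M *
      ∑ x ∈ (univ : Finset (Fin 2 → SpaceTimeIdx L M)).filter (fun x => x 0 = x₀),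
        (1 + ((((x 1).2 - (x 0).2) 0).valMinAbs.natAbs : ℝ) + ((((x 1).2 - (x 0).2) 1).valMinAbs.natAbs : ℝ)) ^ j *
          ‖sectorisedKernel L M β (trivialMultiplier L M) (klEffectiveAction L M β U μ K klE0 n) 2
            (![((0, σ), 0), ((0, σ), 1)] : Fin 2 → SectorLeg 1) x‖ ≤ Ms) :
    ∑ y : TorusSite 2 L, (1 + ((y 0).valMinAbs.natAbs : ℝ) + ((y 1).valMinAbs.natAbs : ℝ)) ^ j *
        ‖torusFourierInv (fun k : TorusSite 2 L => ((klLocSelfEnergyRe L M β U μ K n k : ℝ) : ℂ)) y‖ ≤ 2 * Ms := by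
  set G := klEffectiveAction L M β U μ K klE0 n with hG
  set w : TorusSite 2 L → ℝ := fun y => (1 + ((y 0).valMinAbs.natAbs : ℝ) + ((y 1).valMinAbs.natAbs : ℝ)) ^ j with hw
  have hw0 : ∀ y, 0 ≤ w y := fun y => by rw [hw]; positivity
  -- the four pieces
  set f : MatsubaraIdx M → Fin 2 → TorusSite 2 L → ℂ := fun m σ k => selfEnergy L M β G (m, k) σ with hf
  have hdata : (fun k : TorusSite 2 L => ((klLocSelfEnergyRe L M β U μ K n k : ℝ) : ℂ)) = fun k => (1 / 4 : ℂ) *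
      (((((f (omega0 M) 0 k).re : ℝ) : ℂ) + ((((f (omega0 M).rev 0 k).re : ℝ) : ℂ))) +
        ((((f (omega0 M) 1 k).re : ℝ) : ℂ) + (((f (omega0 M).rev 1 k).re : ℝ) : ℂ))) := by
    funext k
    simp only [klLocSelfEnergyRe, klSelfEnergy, hf, hG, Fin.sum_univ_two]
    push_cast
    ring
  have hlin : ∀ y, torusFourierInv (fun k : TorusSite 2 L => ((klLocSelfEnergyRe L M β U μ K n k : ℝ) : ℂ)) y = (1 / 4 : ℂ) *
      ((torusFourierInv (fun k => (((f (omega0 M) 0 k).re : ℝ) : ℂ)) y + torusFourierInv (fun k => (((f (omega0 M).rev 0 k).re : ℝ) : ℂ)) y) +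
        (torusFourierInv (fun k => (((f (omega0 M) 1 k).re : ℝ) : ℂ)) y + torusFourierInv (fun k => (((f (omega0 M).rev 1 k).re : ℝ) : ℂ)) y)) := by
    intro y
    rw [hdata, torusFourierInv_const_mul]
    congr 1
    rw [torusFourierInv_add (fun k => (((f (omega0 M) 0 k).re : ℝ) : ℂ) + (((f (omega0 M).rev 0 k).re : ℝ) : ℂ))
      (fun k => (((f (omega0 M) 1 k).re : ℝ) : ℂ) + (((f (omega0 M).rev 1 k).re : ℝ) : ℂ)), torusFourierInv_add, torusFourierInv_add]
  -- each piece: `Σ_y w‖(Re f)ˇ‖ ≤ Σ_y w‖f̌‖ ≤ 2Ms`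
  have hb : ∀ (m : MatsubaraIdx M) (σ : Fin 2), ∑ y, w y * ‖torusFourierInv (fun k => (((f m σ k).re : ℝ) : ℂ)) y‖ ≤ 2 * Ms := by
    intro m σ
    refine (sum_momentWeight_norm_torusFourierInv_re_le j (f m σ)).trans ?_
    exact sum_momentWeight_norm_torusFourierInv_selfEnergy_le hβ G m σ j (hMs σ)
  have hpt : ∀ y, w y * ‖torusFourierInv (fun k : TorusSite 2 L => ((klLocSelfEnergyRe L M β U μ K n k : ℝ) : ℂ)) y‖ ≤ (1 / 4 : ℝ) *
      ((w y * ‖torusFourierInv (fun k => (((f (omega0 M) 0 k).re : ℝ) : ℂ)) y‖ + w y * ‖torusFourierInv (fun k => (((f (omega0 M).rev 0 k).re : ℝ) : ℂ)) y‖) +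
        (w y * ‖torusFourierInv (fun k => (((f (omega0 M) 1 k).re : ℝ) : ℂ)) y‖ + w y * ‖torusFourierInv (fun k => (((f (omega0 M).rev 1 k).re : ℝ) : ℂ)) y‖)) := by
    intro y
    rw [hlin, norm_mul]
    have h14 : ‖(1 / 4 : ℂ)‖ = 1 / 4 := by simp
    rw [h14]
    have h1 := norm_add_le (torusFourierInv (fun k => (((f (omega0 M) 0 k).re : ℝ) : ℂ)) y + torusFourierInv (fun k => (((f (omega0 M).rev 0 k).re : ℝ) : ℂ)) y)
      (torusFourierInv (fun k => (((f (omega0 M) 1 k).re : ℝ) : ℂ)) y + torusFourierInv (fun k => (((f (omega0 M).rev 1 k).re : ℝ) : ℂ)) y)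
    have h2 := norm_add_le (torusFourierInv (fun k => (((f (omega0 M) 0 k).re : ℝ) : ℂ)) y) (torusFourierInv (fun k => (((f (omega0 M).rev 0 k).re : ℝ) : ℂ)) y)
    have h3 := norm_add_le (torusFourierInv (fun k => (((f (omega0 M) 1 k).re : ℝ) : ℂ)) y) (torusFourierInv (fun k => (((f (omega0 M).rev 1 k).re : ℝ) : ℂ)) y)
    have hwy := hw0 y
    nlinarith
  calc ∑ y, w y * ‖torusFourierInv (fun k : TorusSite 2 L => ((klLocSelfEnergyRe L M β U μ K n k : ℝ) : ℂ)) y‖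
      ≤ ∑ y, (1 / 4 : ℝ) *
          ((w y * ‖torusFourierInv (fun k => (((f (omega0 M) 0 k).re : ℝ) : ℂ)) y‖ + w y * ‖torusFourierInv (fun k => (((f (omega0 M).rev 0 k).re : ℝ) : ℂ)) y‖) +
            (w y * ‖torusFourierInv (fun k => (((f (omega0 M) 1 k).re : ℝ) : ℂ)) y‖ + w y * ‖torusFourierInv (fun k => (((f (omega0 M).rev 1 k).re : ℝ) : ℂ)) y‖)) :=
        sum_le_sum fun y _ => hpt y
    _ = (1 / 4 : ℝ) * (((∑ y, w y * ‖torusFourierInv (fun k => (((f (omega0 M) 0 k).re : ℝ) : ℂ)) y‖) +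
          ∑ y, w y * ‖torusFourierInv (fun k => (((f (omega0 M).rev 0 k).re : ℝ) : ℂ)) y‖) +
          ((∑ y, w y * ‖torusFourierInv (fun k => (((f (omega0 M) 1 k).re : ℝ) : ℂ)) y‖) +
            ∑ y, w y * ‖torusFourierInv (fun k => (((f (omega0 M).rev 1 k).re : ℝ) : ℂ)) y‖)) := by
        rw [← mul_sum, sum_add_distrib, sum_add_distrib, sum_add_distrib]
    _ ≤ (1 / 4 : ℝ) * ((2 * Ms + 2 * Ms) + (2 * Ms + 2 * Ms)) := by
        gcongr
        · exact hb _ _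
        · exact hb _ _
        · exact hb _ _
        · exact hb _ _
    _ = 2 * Ms := by ring
/-! ## §3 The `c` channel: moments of the odd Matsubara average from the TIME × space weighted pinned norms -/

/-- **y-resolved inversion of the odd frequency difference**: with `P = |Λ|`, `W = W(σ;·)`, for every `y`,
`P²·‖𝔉⁻¹[k⃗ ↦ F₂((ω₀,k⃗),σ)](y) − 𝔉⁻¹[k⃗ ↦ F₂((−ω₀,k⃗),σ)](y)‖ ≤ Σ_{x : x⃗₁ − x⃗₀ = y} ‖W(x)‖·(2π/β)·ε·circDist_{2M}(t₀,t₁)`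
(`‖e^{iω₀Δt} − e^{−iω₀Δt}‖ = 2|sin((π/β)Δt)| ≤ (2π/β)·ε·circDist`). [cite: BenfattoGiulianiMastropietro2006, §2.1 (2.4)–(2.5)] -/
theorem card_sq_mul_norm_torusFourierInv_kernel_two_sub_rev_le [NeZero M] {β : ℝ} (hβ : 0 < β) (G : HubbardGrassmann L M) (σ : Fin 2)
    (y : TorusSite 2 L) :
    (Fintype.card (SpaceTimeIdx L M) : ℝ) ^ 2 *
        ‖torusFourierInv (fun kv : TorusSite 2 L => kernel ℂ G 2 ![(((omega0 M, kv), σ), 0), (((omega0 M, kv), σ), 1)]) y -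
          torusFourierInv (fun kv : TorusSite 2 L => kernel ℂ G 2 ![((((omega0 M).rev, kv), σ), 0), ((((omega0 M).rev, kv), σ), 1)]) y‖ ≤
      ∑ x : Fin 2 → SpaceTimeIdx L M, if y = (x 1).2 - (x 0).2 then
        ‖sectorisedKernel L M β (trivialMultiplier L M) G 2 (![((0, σ), 0), ((0, σ), 1)] : Fin 2 → SectorLeg 1) x‖ *
          (2 * (Real.pi / β) * (imagTimeWeight β M * (circDist (2 * M) (x 0).1.val (x 1).1.val : ℝ)))
      else 0 := by
  set W := sectorisedKernel L M β (trivialMultiplier L M) G 2 (![((0, σ), 0), ((0, σ), 1)] : Fin 2 → SectorLeg 1) with hW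
  -- the two identities (empty fixed-leg string)
  have hΩ : (Fin.cons ((0, σ), 0) (Fin.cons ((0, σ), 1) fun j : Fin 0 =>
      ((((0 : Fin 1), ((![] : Fin 0 → HubbardFieldIdx L M) j).1.2), ((![] : Fin 0 → HubbardFieldIdx L M) j).2) : SectorLeg 1)) :
        Fin 2 → SectorLeg 1) = ![((0, σ), 0), ((0, σ), 1)] := by
    funext i; fin_cases i <;> rfl
  have hlegs : ∀ (n : MatsubaraIdx M) (kv : TorusSite 2 L), (Fin.cons ((((n, kv), σ), 0) : HubbardFieldIdx L M)
      (Fin.cons (((n, kv), σ), 1) (![] : Fin 0 → HubbardFieldIdx L M)) : Fin 2 → HubbardFieldIdx L M) =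
        ![((((n, kv), σ), 0) : HubbardFieldIdx L M), (((n, kv), σ), 1)] := fun n kv => by
    funext i; fin_cases i <;> rfl
  have hid : ∀ n : MatsubaraIdx M, (Fintype.card (SpaceTimeIdx L M) : ℂ) ^ 2 *
      torusFourierInv (fun kv : TorusSite 2 L => kernel ℂ G 2 ![(((n, kv), σ), 0), (((n, kv), σ), 1)]) y =
      ∑ x : Fin 2 → SpaceTimeIdx L M, if (x 0).2 - (x 1).2 + y = 0 then
        W x * (Complex.exp (((matsubaraFreq β M n * (imagTime β M (x 0).1 - imagTime β M (x 1).1) : ℝ) : ℂ) * I) * 1) else 0 := by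
    intro n
    have h := card_pow_mul_torusFourierInv_kernel_legPair_eq hβ.ne' G n σ (![] : Fin 0 → HubbardFieldIdx L M) y
    simp only [hlegs n, hΩ, zero_add, Finset.univ_eq_empty, Finset.prod_empty, map_one] at h
    rw [hW]
    exact h
  -- subtract
  have hsub : (Fintype.card (SpaceTimeIdx L M) : ℂ) ^ 2 *
      (torusFourierInv (fun kv : TorusSite 2 L => kernel ℂ G 2 ![(((omega0 M, kv), σ), 0), (((omega0 M, kv), σ), 1)]) y -
        torusFourierInv (fun kv : TorusSite 2 L => kernel ℂ G 2 ![((((omega0 M).rev, kv), σ), 0), ((((omega0 M).rev, kv), σ), 1)]) y) =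
      ∑ x : Fin 2 → SpaceTimeIdx L M, if (x 0).2 - (x 1).2 + y = 0 then
        W x * (Complex.exp ((((Real.pi / β * (imagTime β M (x 0).1 - imagTime β M (x 1).1) : ℝ)) : ℂ) * I) -
          Complex.exp (-(((Real.pi / β * (imagTime β M (x 0).1 - imagTime β M (x 1).1) : ℝ)) : ℂ) * I)) else 0 := by
    rw [mul_sub, hid (omega0 M), hid (omega0 M).rev, ← sum_sub_distrib]
    refine sum_congr rfl fun x _ => ?_
    split_ifs with h
    · rw [matsubaraFreq_omega0, matsubaraFreq_omega0_rev, mul_one, mul_one, ← mul_sub]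
      congr 2
      push_cast
      ring_nf
    · rw [sub_zero]
  have hnorm := congrArg (fun z : ℂ => ‖z‖) hsub
  simp only [norm_mul, norm_pow, Complex.norm_natCast] at hnorm
  rw [hnorm]
  refine (norm_sum_le _ _).trans (sum_le_sum fun x _ => ?_)
  have hiff : (x 0).2 - (x 1).2 + y = 0 ↔ y = (x 1).2 - (x 0).2 := by
    rw [add_eq_zero_iff_neg_eq, neg_sub, eq_comm]
  by_cases hy : y = (x 1).2 - (x 0).2
  · rw [if_pos (hiff.2 hy), if_pos hy, norm_mul, norm_cexp_mul_I_sub_cexp_neg_mul_I]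
    exact mul_le_mul_of_nonneg_left (two_abs_sin_time_le hβ (x 0).1 (x 1).1) (norm_nonneg _)
  · rw [if_neg (fun h' => hy (hiff.1 h')), if_neg hy, norm_zero]

/-- **Weighted moments of `𝔉⁻¹[F₂(ω₀,·) − F₂(−ω₀,·)]` from the TIME × space weighted pinned norm**: if
`ε·Σ_{x : x 0 = x₀} w(x⃗₁ − x⃗₀)·(ε·circDist_{2M}(t₀,t₁))·‖W(σ;x)‖ ≤ Mt` for every pin, then `Σ_y w(y)‖…‖ ≤ (2π/β)·Mt/(βL²)`.
[cite: BenfattoGiulianiMastropietro2006, §2.1 (2.4)–(2.5)] -/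
theorem sum_weight_norm_torusFourierInv_kernel_two_sub_rev_le [NeZero M] {β : ℝ} (hβ : 0 < β) (G : HubbardGrassmann L M) (σ : Fin 2)
    {w : TorusSite 2 L → ℝ} (hw : ∀ z, 0 ≤ w z) {Mt : ℝ}
    (hMt : ∀ x₀ : SpaceTimeIdx L M, imagTimeWeight β M *
      ∑ x ∈ (univ : Finset (Fin 2 → SpaceTimeIdx L M)).filter (fun x => x 0 = x₀),
        w ((x 1).2 - (x 0).2) * (imagTimeWeight β M * (circDist (2 * M) (x 0).1.val (x 1).1.val : ℝ)) *
          ‖sectorisedKernel L M β (trivialMultiplier L M) G 2 (![((0, σ), 0), ((0, σ), 1)] : Fin 2 → SectorLeg 1) x‖ ≤ Mt) :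
    ∑ y : TorusSite 2 L, w y *
        ‖torusFourierInv (fun kv : TorusSite 2 L => kernel ℂ G 2 ![(((omega0 M, kv), σ), 0), (((omega0 M, kv), σ), 1)]) y -
          torusFourierInv (fun kv : TorusSite 2 L => kernel ℂ G 2 ![((((omega0 M).rev, kv), σ), 0), ((((omega0 M).rev, kv), σ), 1)]) y‖ ≤
      2 * (Real.pi / β) * Mt / (β * (L : ℝ) ^ 2) := by
  set W := sectorisedKernel L M β (trivialMultiplier L M) G 2 (![((0, σ), 0), ((0, σ), 1)] : Fin 2 → SectorLeg 1) with hW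
  set D : TorusSite 2 L → ℝ := fun y => ‖torusFourierInv (fun kv : TorusSite 2 L => kernel ℂ G 2 ![(((omega0 M, kv), σ), 0), (((omega0 M, kv), σ), 1)]) y -
      torusFourierInv (fun kv : TorusSite 2 L => kernel ℂ G 2 ![((((omega0 M).rev, kv), σ), 0), ((((omega0 M).rev, kv), σ), 1)]) y‖ with hD
  set d : (Fin 2 → SpaceTimeIdx L M) → TorusSite 2 L := fun x => (x 1).2 - (x 0).2 with hd
  set τ : (Fin 2 → SpaceTimeIdx L M) → ℝ := fun x => imagTimeWeight β M * (circDist (2 * M) (x 0).1.val (x 1).1.val : ℝ) with hτ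
  set P : ℝ := (Fintype.card (SpaceTimeIdx L M) : ℝ) with hP
  have hPpos : 0 < P := by
    rw [hP]; exact_mod_cast (Fintype.card_pos_iff.2 ⟨(omega0 M, 0)⟩ : 0 < Fintype.card (SpaceTimeIdx L M))
  have hεpos : 0 < imagTimeWeight β M := by
    unfold imagTimeWeight
    have : (0 : ℝ) < M := by
      have hM : 0 < 2 * M := (omega0 M).pos
      exact_mod_cast Nat.pos_of_mul_pos_left hM
    positivity
  have hεP : imagTimeWeight β M * P = β * (L : ℝ) ^ 2 := imagTimeWeight_mul_card β L M
  have hτ0 : ∀ x, 0 ≤ τ x := fun x => by rw [hτ]; exact mul_nonneg hεpos.le (Nat.cast_nonneg _)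
  have hω : 0 ≤ 2 * (Real.pi / β) := by positivity
  -- total weighted mass, sliced by the pinned leg
  have htot : ∑ x : Fin 2 → SpaceTimeIdx L M, w (d x) * τ x * ‖W x‖ ≤ P * (Mt / imagTimeWeight β M) := by
    rw [← sum_fiberwise_of_maps_to (s := univ) (t := (univ : Finset (SpaceTimeIdx L M))) (g := fun x => x 0)
      (fun _ _ => mem_univ _)]
    have hPsum : P * (Mt / imagTimeWeight β M) = ∑ _x₀ : SpaceTimeIdx L M, Mt / imagTimeWeight β M := by
      rw [sum_const, card_univ, nsmul_eq_mul, hP]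
    rw [hPsum]
    refine sum_le_sum fun x₀ _ => ?_
    rw [le_div_iff₀ hεpos, mul_comm]
    exact hMt x₀
  -- the collapsed sum
  have hcol : ∑ y : TorusSite 2 L, w y * (∑ x : Fin 2 → SpaceTimeIdx L M, if y = d x then ‖W x‖ * (2 * (Real.pi / β) * τ x) else 0) =
      2 * (Real.pi / β) * ∑ x : Fin 2 → SpaceTimeIdx L M, w (d x) * τ x * ‖W x‖ := by
    simp_rw [mul_sum, mul_ite, mul_zero]
    rw [sum_comm]
    refine sum_congr rfl fun x _ => ?_
    rw [sum_ite_eq' univ (d x) (fun y => w y * (‖W x‖ * (2 * (Real.pi / β) * τ x))), if_pos (mem_univ _)]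
    ring
  -- pointwise bound, summed
  have hpt : ∀ y, w y * D y ≤ w y * ((∑ x : Fin 2 → SpaceTimeIdx L M, if y = d x then ‖W x‖ * (2 * (Real.pi / β) * τ x) else 0) / P ^ 2) := fun y =>
    mul_le_mul_of_nonneg_left ((le_div_iff₀ (pow_pos hPpos 2)).2 (by
      rw [mul_comm]; exact card_sq_mul_norm_torusFourierInv_kernel_two_sub_rev_le hβ G σ y)) (hw y)
  calc ∑ y, w y * D y
      ≤ ∑ y, w y * ((∑ x : Fin 2 → SpaceTimeIdx L M, if y = d x then ‖W x‖ * (2 * (Real.pi / β) * τ x) else 0) / P ^ 2) :=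
        sum_le_sum fun y _ => hpt y
    _ = (∑ y : TorusSite 2 L, w y * (∑ x : Fin 2 → SpaceTimeIdx L M, if y = d x then ‖W x‖ * (2 * (Real.pi / β) * τ x) else 0)) / P ^ 2 := by
        rw [sum_div]; exact sum_congr rfl fun y _ => by ring
    _ = 2 * (Real.pi / β) * (∑ x : Fin 2 → SpaceTimeIdx L M, w (d x) * τ x * ‖W x‖) / P ^ 2 := by rw [hcol]
    _ ≤ 2 * (Real.pi / β) * (P * (Mt / imagTimeWeight β M)) / P ^ 2 := by gcongr
    _ = 2 * (Real.pi / β) * Mt / (imagTimeWeight β M * P) := by field_simp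
    _ = 2 * (Real.pi / β) * Mt / (β * (L : ℝ) ^ 2) := by rw [hεP]

/-- **Weighted moments of `𝔉⁻¹[k⃗ ↦ Σ((ω₀,k⃗),σ) − Σ((−ω₀,k⃗),σ)]`**: `≤ 4(π/β)·Mt` under the TIME × space weighted pinned bound `Mt` (weight `w_j`).
[cite: BenfattoGiulianiMastropietro2006, §2.1 (2.4)–(2.5)] -/
theorem sum_momentWeight_norm_torusFourierInv_selfEnergy_sub_rev_le [NeZero M] {β : ℝ} (hβ : 0 < β) (G : HubbardGrassmann L M) (σ : Fin 2) (j : ℕ)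
    {Mt : ℝ}
    (hMt : ∀ x₀ : SpaceTimeIdx L M, imagTimeWeight β M *
      ∑ x ∈ (univ : Finset (Fin 2 → SpaceTimeIdx L M)).filter (fun x => x 0 = x₀),
        (1 + ((((x 1).2 - (x 0).2) 0).valMinAbs.natAbs : ℝ) + ((((x 1).2 - (x 0).2) 1).valMinAbs.natAbs : ℝ)) ^ j *
          (imagTimeWeight β M * (circDist (2 * M) (x 0).1.val (x 1).1.val : ℝ)) *
          ‖sectorisedKernel L M β (trivialMultiplier L M) G 2 (![((0, σ), 0), ((0, σ), 1)] : Fin 2 → SectorLeg 1) x‖ ≤ Mt) :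
    ∑ y : TorusSite 2 L, (1 + ((y 0).valMinAbs.natAbs : ℝ) + ((y 1).valMinAbs.natAbs : ℝ)) ^ j *
        ‖torusFourierInv (fun kv : TorusSite 2 L => selfEnergy L M β G (omega0 M, kv) σ - selfEnergy L M β G ((omega0 M).rev, kv) σ) y‖ ≤
      4 * (Real.pi / β) * Mt := by
  have hL : (0 : ℝ) < (L : ℝ) := by exact_mod_cast Nat.pos_of_ne_zero (NeZero.ne L)
  have hker := sum_weight_norm_torusFourierInv_kernel_two_sub_rev_le hβ G σ
    (w := fun z => (1 + ((z 0).valMinAbs.natAbs : ℝ) + ((z 1).valMinAbs.natAbs : ℝ)) ^ j) (fun z => by positivity) hMt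
  have hfun : (fun kv : TorusSite 2 L => selfEnergy L M β G (omega0 M, kv) σ - selfEnergy L M β G ((omega0 M).rev, kv) σ) =
      fun kv => ((2 * (β * (L : ℝ) ^ 2) : ℝ) : ℂ) * (kernel ℂ G 2 ![(((omega0 M, kv), σ), 0), (((omega0 M, kv), σ), 1)] -
        kernel ℂ G 2 ![((((omega0 M).rev, kv), σ), 0), ((((omega0 M).rev, kv), σ), 1)]) := by
    funext kv; rw [selfEnergy_eq_vertexFn, selfEnergy_eq_vertexFn, mul_sub]
  have hpt : ∀ y, ‖torusFourierInv (fun kv : TorusSite 2 L => selfEnergy L M β G (omega0 M, kv) σ - selfEnergy L M β G ((omega0 M).rev, kv) σ) y‖ =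
      (2 * (β * (L : ℝ) ^ 2)) * ‖torusFourierInv (fun kv : TorusSite 2 L => kernel ℂ G 2 ![(((omega0 M, kv), σ), 0), (((omega0 M, kv), σ), 1)]) y -
        torusFourierInv (fun kv : TorusSite 2 L => kernel ℂ G 2 ![((((omega0 M).rev, kv), σ), 0), ((((omega0 M).rev, kv), σ), 1)]) y‖ := by
    intro y
    rw [hfun, torusFourierInv_const_mul, norm_mul, Complex.norm_real, Real.norm_eq_abs, abs_of_pos (by positivity),
      torusFourierInv_sub]
  simp_rw [hpt]
  calc ∑ y : TorusSite 2 L, (1 + ((y 0).valMinAbs.natAbs : ℝ) + ((y 1).valMinAbs.natAbs : ℝ)) ^ j *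
        ((2 * (β * (L : ℝ) ^ 2)) * ‖torusFourierInv (fun kv : TorusSite 2 L => kernel ℂ G 2 ![(((omega0 M, kv), σ), 0), (((omega0 M, kv), σ), 1)]) y -
          torusFourierInv (fun kv : TorusSite 2 L => kernel ℂ G 2 ![((((omega0 M).rev, kv), σ), 0), ((((omega0 M).rev, kv), σ), 1)]) y‖)
      = (2 * (β * (L : ℝ) ^ 2)) * ∑ y : TorusSite 2 L, (1 + ((y 0).valMinAbs.natAbs : ℝ) + ((y 1).valMinAbs.natAbs : ℝ)) ^ j *
          ‖torusFourierInv (fun kv : TorusSite 2 L => kernel ℂ G 2 ![(((omega0 M, kv), σ), 0), (((omega0 M, kv), σ), 1)]) y -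
            torusFourierInv (fun kv : TorusSite 2 L => kernel ℂ G 2 ![((((omega0 M).rev, kv), σ), 0), ((((omega0 M).rev, kv), σ), 1)]) y‖ := by
        rw [mul_sum]; exact sum_congr rfl fun y _ => by ring
    _ ≤ (2 * (β * (L : ℝ) ^ 2)) * (2 * (Real.pi / β) * Mt / (β * (L : ℝ) ^ 2)) := mul_le_mul_of_nonneg_left hker (by positivity)
    _ = 4 * (Real.pi / β) * Mt := by field_simp; ring

/-- **THE `hMm_c/hMs_c` ROWS OF THE (δ′) DOOR FROM POSITION SPACE.**  For the scale-`n` action `klEffectiveAction … K klE0 n` at any frame `K`: if both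
spin strings' trivial-multiplier two-leg position kernels have TIME × space weighted pinned norm `≤ Mt` (weight `w_j(Δx⃗)·ε·circDist(t₀,t₁)`), then
`Σ_y w_j(y)‖𝔉⁻¹[k⃗ ↦ ¼Σ_σ(Im Σ_n[K](ω₀,k⃗,σ) − Im Σ_n[K](−ω₀,k⃗,σ))](y)‖ ≤ 2(π/β)·Mt`. [cite: BenfattoGiulianiMastropietro2006, §2.4 (2.36)] -/
theorem sum_momentWeight_norm_torusFourierInv_oddAverage_le [NeZero M] {β : ℝ} (hβ : 0 < β) (U μ : ℝ) (K : TrigPolyC4v) (n j : ℕ) {Mt : ℝ}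
    (hMt : ∀ (σ : Fin 2) (x₀ : SpaceTimeIdx L M), imagTimeWeight β M *
      ∑ x ∈ (univ : Finset (Fin 2 → SpaceTimeIdx L M)).filter (fun x => x 0 = x₀),
        (1 + ((((x 1).2 - (x 0).2) 0).valMinAbs.natAbs : ℝ) + ((((x 1).2 - (x 0).2) 1).valMinAbs.natAbs : ℝ)) ^ j *
          (imagTimeWeight β M * (circDist (2 * M) (x 0).1.val (x 1).1.val : ℝ)) *
          ‖sectorisedKernel L M β (trivialMultiplier L M) (klEffectiveAction L M β U μ K klE0 n) 2
            (![((0, σ), 0), ((0, σ), 1)] : Fin 2 → SectorLeg 1) x‖ ≤ Mt) :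
    ∑ y : TorusSite 2 L, (1 + ((y 0).valMinAbs.natAbs : ℝ) + ((y 1).valMinAbs.natAbs : ℝ)) ^ j *
        ‖torusFourierInv (fun k : TorusSite 2 L => (((∑ s : Fin 2,
            ((klSelfEnergy L M β U μ K klE0 n (omega0 M, k) s).im - (klSelfEnergy L M β U μ K klE0 n ((omega0 M).rev, k) s).im)) / 4 : ℝ) : ℂ)) y‖ ≤
      2 * (Real.pi / β) * Mt := by
  set G := klEffectiveAction L M β U μ K klE0 n with hG
  set w : TorusSite 2 L → ℝ := fun y => (1 + ((y 0).valMinAbs.natAbs : ℝ) + ((y 1).valMinAbs.natAbs : ℝ)) ^ j with hw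
  have hw0 : ∀ y, 0 ≤ w y := fun y => by rw [hw]; positivity
  set g : Fin 2 → TorusSite 2 L → ℂ := fun σ k => selfEnergy L M β G (omega0 M, k) σ - selfEnergy L M β G ((omega0 M).rev, k) σ with hg
  have hdata : (fun k : TorusSite 2 L => (((∑ s : Fin 2,
      ((klSelfEnergy L M β U μ K klE0 n (omega0 M, k) s).im - (klSelfEnergy L M β U μ K klE0 n ((omega0 M).rev, k) s).im)) / 4 : ℝ) : ℂ)) =
      fun k => (1 / 4 : ℂ) * ((((g 0 k).im : ℝ) : ℂ) + (((g 1 k).im : ℝ) : ℂ)) := by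
    funext k
    simp only [klSelfEnergy, hg, hG, Fin.sum_univ_two, Complex.sub_im]
    push_cast
    ring
  have hlin : ∀ y, torusFourierInv (fun k : TorusSite 2 L => (((∑ s : Fin 2,
      ((klSelfEnergy L M β U μ K klE0 n (omega0 M, k) s).im - (klSelfEnergy L M β U μ K klE0 n ((omega0 M).rev, k) s).im)) / 4 : ℝ) : ℂ)) y =
      (1 / 4 : ℂ) * (torusFourierInv (fun k => (((g 0 k).im : ℝ) : ℂ)) y + torusFourierInv (fun k => (((g 1 k).im : ℝ) : ℂ)) y) := by
    intro y
    rw [hdata, torusFourierInv_const_mul, torusFourierInv_add]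
  have hb : ∀ σ : Fin 2, ∑ y, w y * ‖torusFourierInv (fun k => (((g σ k).im : ℝ) : ℂ)) y‖ ≤ 4 * (Real.pi / β) * Mt := by
    intro σ
    refine (sum_momentWeight_norm_torusFourierInv_im_le j (g σ)).trans ?_
    exact sum_momentWeight_norm_torusFourierInv_selfEnergy_sub_rev_le hβ G σ j (hMt σ)
  have hpt : ∀ y, w y * ‖torusFourierInv (fun k : TorusSite 2 L => (((∑ s : Fin 2,
      ((klSelfEnergy L M β U μ K klE0 n (omega0 M, k) s).im - (klSelfEnergy L M β U μ K klE0 n ((omega0 M).rev, k) s).im)) / 4 : ℝ) : ℂ)) y‖ ≤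
      (1 / 4 : ℝ) * (w y * ‖torusFourierInv (fun k => (((g 0 k).im : ℝ) : ℂ)) y‖ + w y * ‖torusFourierInv (fun k => (((g 1 k).im : ℝ) : ℂ)) y‖) := by
    intro y
    rw [hlin, norm_mul]
    have h14 : ‖(1 / 4 : ℂ)‖ = 1 / 4 := by simp
    rw [h14]
    have h2 := norm_add_le (torusFourierInv (fun k => (((g 0 k).im : ℝ) : ℂ)) y) (torusFourierInv (fun k => (((g 1 k).im : ℝ) : ℂ)) y)
    have hwy := hw0 y
    nlinarith
  calc ∑ y, w y * ‖torusFourierInv (fun k : TorusSite 2 L => (((∑ s : Fin 2,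
        ((klSelfEnergy L M β U μ K klE0 n (omega0 M, k) s).im - (klSelfEnergy L M β U μ K klE0 n ((omega0 M).rev, k) s).im)) / 4 : ℝ) : ℂ)) y‖
      ≤ ∑ y, (1 / 4 : ℝ) * (w y * ‖torusFourierInv (fun k => (((g 0 k).im : ℝ) : ℂ)) y‖ + w y * ‖torusFourierInv (fun k => (((g 1 k).im : ℝ) : ℂ)) y‖) :=
        sum_le_sum fun y _ => hpt y
    _ = (1 / 4 : ℝ) * ((∑ y, w y * ‖torusFourierInv (fun k => (((g 0 k).im : ℝ) : ℂ)) y‖) + ∑ y, w y * ‖torusFourierInv (fun k => (((g 1 k).im : ℝ) : ℂ)) y‖) := by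
        rw [← mul_sum, sum_add_distrib]
    _ ≤ (1 / 4 : ℝ) * (4 * (Real.pi / β) * Mt + 4 * (Real.pi / β) * Mt) := by
        gcongr
        · exact hb 0
        · exact hb 1
    _ = 2 * (Real.pi / β) * Mt := by ring
end Summit.HubbardSuperconductivity.HubbardSuperconductivity.Theorems.TwoLegFourier

end
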